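import Mathlib.Analysis.InnerProductSpace.PiL2
import Mathlib.Geometry.Euclidean.Angle.Unoriented.Basic
import HarnessLib

/-!
# Definitions of the HEX-PERIMETER chain ((d3) «one rattler per p-hexagon»): tangent normals and
# tangent points of two caps, the clipped polygon, the perimeter of a periodic walk, a path

HONEST FRAMING. Part of the venture `Summits/Ventures/Crystal3D` (cell `pub-crystal3d`, phase 2;
seat typer-bulk-2), generic and configuration-free; nothing here mentions GAP(1.26). This file
only holds the DEFINITIONS used by the theorem files `Bulk/TwoCapTangents.lean`,
`Bulk/SphPolygonCut.lean`, `Bulk/SphPolygonCutPerim.lean`, `Bulk/HexPathSum.lean`,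
`Bulk/HexagonTwoRattlers.lean` (plan `HOME/lean/hexper/README.md`; the cross product `cross3`
and the sixty-degree point `sixtyPoint` are in `Bulk/SphSegmentCap.lean`; this file imports only
Mathlib):

* `tangentNormal z₁ z₂ a b = a (z₁ + z₂) + b (z₁ × z₂)` — with `3a/2 = s`, `3a² + (3/4)b² = 1` the
  unit normal of a common tangent great circle of the two caps of height `s` about `z₁, z₂`;
* `tangentPoint z n s = (z − s n)/√(1 − s²)` — the tangent point of the cap about `z` with `n⊥`;
* `cutB w ν k`, `cutA w ν n`, `cutPoly w ν n k` — the two crossing points of the great circle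
  `ν⊥` with the sides `(w (k−1), w k)` and `(w (n−1), w 0)` of a periodic walk `w`, and the
  clipped walk `w 0, …, w (k−1), cutB, cutA` (period `k + 2`);
* `polyPerim v m = Σ_{j<m} ∠(v j, v (j+1))` — the perimeter of a periodic walk;
* `pathSeq A g L B` — the path `A, g 1, …, g L, B`.
-/

noncomputable section

namespace Summit.Ventures.Crystal3D

open Real InnerProductGeometry Finset
open scoped InnerProductSpace RealInnerProductSpace

/-- A vector in the frame of the two centres: `a (z₁ + z₂) + b (z₁ × z₂)` (the cross product
written out in coordinates; it is `cross3 z₁ z₂` of `Bulk/SphSegmentCap.lean`, definitionally —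
`tangentNormal_eq` in `Bulk/TwoCapTangents.lean`). With `3a/2 = s` and `3a² + (3/4)b² = 1` it is
the unit normal of a common tangent great circle of the two caps of height `s` about `z₁, z₂`
(`⟪z₁, z₂⟫ = 1/2`). -/
def tangentNormal (z₁ z₂ : EuclideanSpace ℝ (Fin 3)) (a b : ℝ) : EuclideanSpace ℝ (Fin 3) :=
  a • (z₁ + z₂) + b • (WithLp.equiv 2 (Fin 3 → ℝ)).symm
    ![z₁ 1 * z₂ 2 - z₁ 2 * z₂ 1, z₁ 2 * z₂ 0 - z₁ 0 * z₂ 2, z₁ 0 * z₂ 1 - z₁ 1 * z₂ 0]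

/-- The tangent point of the cap of height `s` about `z` with the great circle `n⊥`:
`(z − s n)/√(1 − s²)`. -/
def tangentPoint (z n : EuclideanSpace ℝ (Fin 3)) (s : ℝ) : EuclideanSpace ℝ (Fin 3) :=
  (1 / Real.sqrt (1 - s ^ 2)) • (z - s • n)

/-- The crossing point on the edge `(w (k−1), w k)`: `σ(k−1) w k − σ k w (k−1)` (`σ = ⟪·, ν⟫`). -/
def cutB (w : ℕ → EuclideanSpace ℝ (Fin 3)) (ν : EuclideanSpace ℝ (Fin 3)) (k : ℕ) :
    EuclideanSpace ℝ (Fin 3) :=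
  ⟪w (k - 1), ν⟫ • w k + (-⟪w k, ν⟫) • w (k - 1)

/-- The crossing point on the edge `(w (n−1), w 0)`: `σ 0 w (n−1) − σ (n−1) w 0`. -/
def cutA (w : ℕ → EuclideanSpace ℝ (Fin 3)) (ν : EuclideanSpace ℝ (Fin 3)) (n : ℕ) :
    EuclideanSpace ℝ (Fin 3) :=
  ⟪w 0, ν⟫ • w (n - 1) + (-⟪w (n - 1), ν⟫) • w 0

/-- **The clipped polygon** `w 0, …, w (k−1), B, A` (period `k + 2`). -/
def cutPoly (w : ℕ → EuclideanSpace ℝ (Fin 3)) (ν : EuclideanSpace ℝ (Fin 3)) (n k : ℕ) (j : ℕ) :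
    EuclideanSpace ℝ (Fin 3) :=
  if j % (k + 2) < k then w (j % (k + 2)) else if j % (k + 2) = k then cutB w ν k else cutA w ν n

/-- The perimeter of a polygon given as a periodic sequence: `Σ_{j<m} ∠(v j, v (j+1))`. -/
def polyPerim (v : ℕ → EuclideanSpace ℝ (Fin 3)) (m : ℕ) : ℝ :=
  ∑ j ∈ range m, angle (v j) (v (j + 1))

/-- The path `A, g 1, …, g L, B`. -/
def pathSeq (A : EuclideanSpace ℝ (Fin 3)) (g : ℕ → EuclideanSpace ℝ (Fin 3)) (L : ℕ)
    (B : EuclideanSpace ℝ (Fin 3)) (t : ℕ) : EuclideanSpace ℝ (Fin 3) :=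
  if t = 0 then A else if t ≤ L then g t else B

end Summit.Ventures.Crystal3D

end
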